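import Literature.Computability.AlgebraicComplexity.GenericFormsNonsingular
import Literature.Computability.AlgebraicComplexity.BI17DegreeExponentMonoidProofs
import Literature.Computability.AlgebraicComplexity.BI17ChowPowerSumPolystableProofs
import Literature.Computability.AlgebraicComplexity.SmoothFormAnnihilatorSemisimple
import HarnessLib

/-!
# An `SL_m`-invariant separating the Fermat orbit from the singular forms

Support file for the Mumford route to Bürgisser–Ikenmeyer 2017, Prop. 2.10 ("if `D > 1`, then
almost all `w ∈ Sym^D ℂ^m` are polystable", `BI17FundamentalInvariantForms.lean`, row BI2017-A of
the val-lit cell), the INVARIANT-THEORY HALF: for every degree `D ≥ 2` and every number of variables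
`n + 2 ≥ 2` there is an `SL_{n+2}(ℂ)`-invariant polynomial function `q` on `Sym^D ℂ^{n+2}`
(`IsSLInvariantCoord D q`) with

* `q(x₀^D + ⋯ + x_{n+1}^D) = 1`, and
* `q(G) = 0` for every SINGULAR form `G` of degree `D` (`¬ IsNonsingularForm ℂ G`)

(`exists_isSLInvariantCoord_fermat_one_singular_zero`). Classically `q` would be the discriminant;
here NO discriminant is written down: the two `SL`-stable Zariski closed subsets
`Z₁ = SL · ΣX_i^D` (a closed orbit — the Fermat form is polystable, BI Cor. 2.9, tree
`BI2017_cor_2_9_chow_powerSum_holds`) and `Z₂` = the singular forms (closed by the main theorem of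
elimination theory, the tree's `isClosed_setOf_exists_common_zero`, exactly as in val-lit-p4 g5's
`GenericFormsNonsingular.lean`) are disjoint (the Fermat form and its `SL`-translates are nonsingular,
`isNonsingularForm_sum_X_pow`, `isNonsingularForm_linSubst`), hence SEPARATED BY AN INVARIANT
(Mumford–Fogarty–Kirwan, GIT Ch. 1 §2 Cor. 1.2): Nullstellensatz (`1 = a + b`, tree
`exists_mem_vanishingIdeal_add_eq_one_of_disjoint`) followed by the Reynolds splitting of invariant
vectors in the completely reducible `SL_m`-representation `ℂ[Sym^D ℂ^m]` (tree
`exists_invariant_add_eq_of_mem_sup`, `isSemisimpleRepresentation_coordRep_comp_toGL`;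
pattern of `exists_isSLInvariantCoord_separating_smul`, `BI17DegreeExponentMonoidProofs.lean`).

Also filed: the Euler-identity reading of singularity used on the way
(`not_isNonsingularForm_iff_exists_common_zero_pderiv`) and the `SL`-invariance of singularity.

Theorem-only file (no definitions, no named facts). Honest framing: classical invariant theory
(existence of an invariant vanishing on the discriminant locus); nothing here bears on VP versus VNP.

## References

* D. Mumford, J. Fogarty, F. Kirwan, *Geometric Invariant Theory*, 3rd ed. (1994), Ch. 1 §2
  Cor. 1.2 (disjoint closed invariant subsets are separated by an invariant) and Ch. 4 §2 Prop. 4.2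
  (the discriminant as the separating invariant). [MumfordFogartyKirwan1994]
* P. Bürgisser, C. Ikenmeyer, *Fundamental invariants of orbit closures*, J. Algebra 477 (2017),
  Cor. 2.9, Prop. 2.10. [BurgisserIkenmeyer2017]
* R. Hartshorne, *Algebraic Geometry* (1977), I Ex. 5.8 (nonsingular forms). [Hartshorne1977]
-/

noncomputable section

open MvPolynomial

namespace Literature.Computability.AlgebraicComplexity

open _root_.Literature.AlgebraicGeometry.Motives.SmoothHypersurface

section Singular

variable {n D : ℕ}

/-- **Singular forms through the Euler identity**: a form `G` of degree `D ≥ 1` over `ℂ` is NOT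
nonsingular iff its partial derivatives have a common zero `x ≠ 0` (then `D·G(x) = Σ xⱼ ∂ⱼG(x) = 0`
by Euler, so `x` is a singular point of `{G = 0}`). [cite: Hartshorne1977, I Ex. 5.8] -/
theorem not_isNonsingularForm_iff_exists_common_zero_pderiv {G : MvPolynomial (Fin (n + 2)) ℂ}
    (hG : G.IsHomogeneous D) (hD : 0 < D) :
    ¬ IsNonsingularForm ℂ G ↔
      ∃ x : Fin (n + 2) → ℂ, x ≠ 0 ∧ ∀ j, eval x (pderiv j G) = 0 := by
  constructor
  · intro h
    by_contra hno
    push Not at hno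
    apply h
    refine isNonsingularForm_of_forall_exists_eval_pderiv_ne_zero fun z hz _ => ?_
    exact hno z hz
  · rintro ⟨x, hx, hzero⟩ hns
    -- Euler: `D · G(x) = Σ_j x_j (∂_j G)(x) = 0`, so `G(x) = 0`
    have hE := congr_arg (eval x) hG.sum_X_mul_pderiv
    rw [map_sum, map_nsmul] at hE
    have hGx : eval x G = 0 := by
      have h0 : (∑ j, eval x (X j * pderiv j G)) = 0 :=
        Finset.sum_eq_zero fun j _ => by rw [map_mul, hzero j, mul_zero]
      rw [h0, nsmul_eq_mul] at hE
      exact (mul_eq_zero.mp hE.symm).resolve_left (Nat.cast_ne_zero.mpr hD.ne')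
    obtain ⟨j, hj⟩ := hns.exists_eval_pderiv_ne_zero hx hGx
    exact hj (hzero j)

/-- Singularity is `SL`-invariant: `h · G` is singular whenever `G` is (`G = h⁻¹ · (h · G)` and
nonsingularity is preserved by invertible substitutions, tree `isNonsingularForm_linSubst`).
[cite: Hartshorne1977, I Ex. 5.8] -/
theorem not_isNonsingularForm_linSubst_of_not {G : MvPolynomial (Fin (n + 2)) ℂ}
    (hG : ¬ IsNonsingularForm ℂ G) (h : Matrix.SpecialLinearGroup (Fin (n + 2)) ℂ) :
    ¬ IsNonsingularForm ℂ (linSubst (Fin (n + 2)) ℂ (h : Matrix (Fin (n + 2)) (Fin (n + 2)) ℂ) G) := by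
  intro hns
  apply hG
  have hback : G = linSubst (Fin (n + 2)) ℂ ((h⁻¹ : Matrix.SpecialLinearGroup (Fin (n + 2)) ℂ) :
      Matrix (Fin (n + 2)) (Fin (n + 2)) ℂ)
      (linSubst (Fin (n + 2)) ℂ (h : Matrix (Fin (n + 2)) (Fin (n + 2)) ℂ) G) := by
    rw [← AlgHom.comp_apply, ← linSubst_mul, ← Matrix.SpecialLinearGroup.coe_mul, inv_mul_cancel,
      Matrix.SpecialLinearGroup.coe_one, linSubst_one, AlgHom.id_apply]
  rw [hback]
  refine isNonsingularForm_linSubst _ ?_ hns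
  rw [Matrix.SpecialLinearGroup.det_coe]
  exact isUnit_one

/-- A coefficient vector is the coefficient vector of the form it defines. [folklore] -/
private theorem formCoeff_sum_monomial' (c : DegIdx (Fin (n + 2)) D → ℂ) :
    formCoeff D (∑ d : DegIdx (Fin (n + 2)) D, monomial d.1 (c d)) = c := by
  funext d
  rw [formCoeff_apply, coeff_sum, Finset.sum_eq_single d]
  · rw [coeff_monomial, if_pos rfl]
  · intro d' _ hne
    rw [coeff_monomial, if_neg (fun h => hne (Subtype.ext h))]
  · intro h
    exact absurd (Finset.mem_univ d) h

/-- The form defined by a coefficient vector is homogeneous of degree `D`. [folklore] -/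
private theorem isHomogeneous_sum_monomial' (c : DegIdx (Fin (n + 2)) D → ℂ) :
    (∑ d : DegIdx (Fin (n + 2)) D, monomial d.1 (c d) : MvPolynomial (Fin (n + 2)) ℂ).IsHomogeneous D :=
  IsHomogeneous.sum _ _ _ fun d _ => isHomogeneous_monomial _ (mem_degMonomials_iff.mp d.2)

open Literature.NumberTheory.Automorphic in
/-- **The singular forms of degree `D ≥ 1` are an `SL`-stable Zariski closed subset of `Sym^D`**, in
the concrete form needed for the Nullstellensatz: there is a set `Z₂` of degree-`D` coefficient
vectors, equal to the zero set of its own vanishing ideal, whose vanishing ideal is stable under the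
coordinate action of `SL_{n+2}`, and such that a form `G` of degree `D` is singular iff
`formCoeff D G ∈ Z₂`. Elimination theory on the partials of the generic form (Springer 6.1.3, tree
`isClosed_setOf_exists_common_zero`; pattern of `isZariskiGeneric_isNonsingularForm`).
[cite: MumfordFogartyKirwan1994, Ch. 4 §2 Prop. 4.2 (the discriminant locus is closed and invariant)] -/
theorem exists_singularLocus_formCoeff (hD : 0 < D) :
    ∃ Z₂ : Set (DegIdx (Fin (n + 2)) D → ℂ),
      MvPolynomial.zeroLocus ℂ (MvPolynomial.vanishingIdeal ℂ Z₂) ⊆ Z₂ ∧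
      (∀ (h : Matrix.SpecialLinearGroup (Fin (n + 2)) ℂ) (Φ : MvPolynomial (DegIdx (Fin (n + 2)) D) ℂ),
        Φ ∈ MvPolynomial.vanishingIdeal ℂ Z₂ →
          coordSubst D (Matrix.SpecialLinearGroup.toGL h) Φ ∈ MvPolynomial.vanishingIdeal ℂ Z₂) ∧
      ∀ G : MvPolynomial (Fin (n + 2)) ℂ, G.IsHomogeneous D →
        (formCoeff D G ∈ Z₂ ↔ ¬ IsNonsingularForm ℂ G) := by
  classical
  -- the generic form of degree `D` over the coefficient ring `ℂ[Sym^D ℂ^{n+2}]`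
  set Gg : MvPolynomial (Fin (n + 2)) (MvPolynomial (DegIdx (Fin (n + 2)) D) ℂ) :=
    ∑ d : DegIdx (Fin (n + 2)) D, C (X d) * monomial d.1 1 with hGg
  have hGhom : Gg.IsHomogeneous D :=
    IsHomogeneous.sum _ _ _ fun d _ =>
      (isHomogeneous_monomial (1 : MvPolynomial (DegIdx (Fin (n + 2)) D) ℂ)
        (mem_degMonomials_iff.mp d.2)).C_mul _
  -- its specialisation at the coefficient vector of a form `F` of degree `D` is `F`
  have hspec : ∀ F : MvPolynomial (Fin (n + 2)) ℂ, F.IsHomogeneous D →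
      specialize (formCoeff D F) Gg = F := by
    intro F hF
    rw [specialize, hGg, map_sum]
    conv_rhs => rw [← sum_coeff_smul_monomial_eq hF]
    refine Finset.sum_congr rfl fun d _ => ?_
    rw [map_mul, map_C, eval_X, map_monomial, map_one, formCoeff_apply, smul_eq_C_mul]
  -- the partial derivatives, homogeneous of degree `D - 1`
  set f : Fin (n + 2) → MvPolynomial (Fin (n + 2)) (MvPolynomial (DegIdx (Fin (n + 2)) D) ℂ) :=
    fun i => pderiv i Gg with hf
  have hfhom : ∀ j, (f j).IsHomogeneous (D - 1) := fun j => hGhom.pderiv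
  have hfspec : ∀ F : MvPolynomial (Fin (n + 2)) ℂ, F.IsHomogeneous D → ∀ j,
      specialize (formCoeff D F) (f j) = pderiv j F := by
    intro F hF j
    rw [hf]
    dsimp only
    rw [specialize, ← pderiv_map, ← specialize, hspec F hF]
  -- the singular locus and its closedness (elimination)
  set Z₂ : Set (DegIdx (Fin (n + 2)) D → ℂ) :=
    {y | ∃ x : Fin (n + 2) → ℂ, x ≠ 0 ∧ ∀ j, eval x (specialize y (f j)) = 0} with hZ₂
  have hS := isClosed_setOf_exists_common_zero f hfhom
  obtain ⟨T, hT⟩ := isClosed_iff_exists_setOf_eval.mp hS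
  -- membership of coefficient vectors of forms
  have hmem : ∀ G : MvPolynomial (Fin (n + 2)) ℂ, G.IsHomogeneous D →
      (formCoeff D G ∈ Z₂ ↔ ¬ IsNonsingularForm ℂ G) := by
    intro G hG
    rw [not_isNonsingularForm_iff_exists_common_zero_pderiv hG hD, hZ₂, Set.mem_setOf_eq]
    simp_rw [hfspec G hG]
  refine ⟨Z₂, ?_, ?_, hmem⟩
  · -- `Z(I(Z₂)) ⊆ Z₂`: `Z₂` is the zero set of `T`
    intro y hy
    rw [MvPolynomial.mem_zeroLocus_iff] at hy
    have hy' : y ∈ {x | ∀ p ∈ T, MvPolynomial.eval x p = 0} := by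
      intro p hp
      have hpI : p ∈ MvPolynomial.vanishingIdeal ℂ Z₂ := by
        rw [MvPolynomial.mem_vanishingIdeal_iff]
        intro z hz
        rw [hZ₂, hT] at hz
        exact hz p hp
      exact hy p hpI
    rw [hZ₂, hT]
    exact hy'
  · -- `SL`-stability of the vanishing ideal
    intro h Φ hΦ
    rw [MvPolynomial.mem_vanishingIdeal_iff] at hΦ ⊢
    intro y hy
    -- `y` is the coefficient vector of the form `G_y` of degree `D`, which is singular
    set Gy : MvPolynomial (Fin (n + 2)) ℂ := ∑ d : DegIdx (Fin (n + 2)) D, monomial d.1 (y d) with hGy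
    have hGyhom : Gy.IsHomogeneous D := isHomogeneous_sum_monomial' y
    have hGy_coeff : formCoeff D Gy = y := formCoeff_sum_monomial' y
    have hGysing : ¬ IsNonsingularForm ℂ Gy := (hmem Gy hGyhom).mp (hGy_coeff ▸ hy)
    rw [← hGy_coeff, aeval_formCoeff_coordSubst, ← map_inv, linSubstRep_apply,
      Matrix.SpecialLinearGroup.coe_GL_coe_matrix]
    refine hΦ _ ((hmem _ (linSubst_isHomogeneous _ hGyhom)).mpr ?_)
    exact not_isNonsingularForm_linSubst_of_not hGysing h⁻¹

/-- **An `SL_{n+2}`-invariant that is `1` at the Fermat form and vanishes on all singular forms of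
degree `D`** (`D ≥ 2`): the closed orbit `SL · ΣX_i^D` (polystable, BI Cor. 2.9; nonsingular) and the
closed `SL`-stable singular locus are disjoint, hence separated by an invariant (GIT Ch. 1 §2
Cor. 1.2: Nullstellensatz + Reynolds). This is the existence of an invariant vanishing on the
discriminant locus and not identically zero — the input of Mumford's Prop. 4.2 — obtained WITHOUT
constructing the discriminant. [cite: MumfordFogartyKirwan1994, Ch. 1 §2 Cor. 1.2 and Ch. 4 §2 Prop. 4.2] -/
theorem exists_isSLInvariantCoord_fermat_one_singular_zero (n : ℕ) (hD : 2 ≤ D) :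
    ∃ q : MvPolynomial (DegIdx (Fin (n + 2)) D) ℂ, IsSLInvariantCoord D q ∧
      aeval (formCoeff D (∑ i : Fin (n + 2), (X i : MvPolynomial (Fin (n + 2)) ℂ) ^ D)) q = 1 ∧
      ∀ G : MvPolynomial (Fin (n + 2)) ℂ, G.IsHomogeneous D → ¬ IsNonsingularForm ℂ G →
        aeval (formCoeff D G) q = 0 := by
  classical
  have hD0 : 0 < D := by omega
  have hm : 0 < n + 2 := by omega
  -- the Fermat form: homogeneous, nonsingular, polystable
  set F₀ : MvPolynomial (Fin (n + 2)) ℂ := ∑ i : Fin (n + 2), X i ^ D with hF₀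
  have hF₀hom : F₀.IsHomogeneous D := IsHomogeneous.sum _ _ _ fun i _ => isHomogeneous_X_pow i D
  have hF₀ns : IsNonsingularForm ℂ F₀ :=
    isNonsingularForm_sum_X_pow (Nat.cast_ne_zero.mpr hD0.ne')
  have hF₀poly : IsPolystable F₀ := BI2017_cor_2_9_chow_powerSum_holds.2 (n + 2) D hD
  -- the two closed sets
  set Z₁ : Set (DegIdx (Fin (n + 2)) D → ℂ) := formCoeff D '' slOrbit (Fin (n + 2)) ℂ F₀ with hZ₁
  have h₁ : MvPolynomial.zeroLocus ℂ (MvPolynomial.vanishingIdeal ℂ Z₁) ⊆ Z₁ :=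
    zeroLocus_vanishingIdeal_subset_of_isPolystable hF₀hom hF₀poly
  obtain ⟨Z₂, h₂, hZ₂stab, hmem⟩ := exists_singularLocus_formCoeff (n := n) (D := D) hD0
  -- they are disjoint: translates of the Fermat form are nonsingular
  have hdisj : Disjoint Z₁ Z₂ := by
    rw [Set.disjoint_left]
    rintro _ ⟨_, ⟨g, rfl⟩, rfl⟩ hy
    have hsing := (hmem _ (linSubst_isHomogeneous _ hF₀hom)).mp hy
    refine hsing (isNonsingularForm_linSubst _ ?_ hF₀ns)
    rw [Matrix.SpecialLinearGroup.det_coe]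
    exact isUnit_one
  -- Nullstellensatz: `1 = a + b`
  obtain ⟨a, ha, b, hb, hab⟩ := exists_mem_vanishingIdeal_add_eq_one_of_disjoint h₁ h₂ hdisj
  -- Reynolds splitting in the completely reducible `SL`-representation `ℂ[Sym^D]`
  set ρ : Representation ℂ (Matrix.SpecialLinearGroup (Fin (n + 2)) ℂ)
      (MvPolynomial (DegIdx (Fin (n + 2)) D) ℂ) :=
    (coordRep (Fin (n + 2)) ℂ D).comp Matrix.SpecialLinearGroup.toGL with hρ
  have hρapp : ∀ (h : Matrix.SpecialLinearGroup (Fin (n + 2)) ℂ)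
      (F : MvPolynomial (DegIdx (Fin (n + 2)) D) ℂ),
      ρ h F = coordSubst D (Matrix.SpecialLinearGroup.toGL h) F := fun _ _ => rfl
  let J₁ : Subrepresentation ρ :=
    ⟨(MvPolynomial.vanishingIdeal ℂ Z₁).restrictScalars ℂ,
      fun h F hF => coordSubst_toGL_mem_vanishingIdeal_slOrbit h hF⟩
  let J₂ : Subrepresentation ρ :=
    ⟨(MvPolynomial.vanishingIdeal ℂ Z₂).restrictScalars ℂ, fun h F hF => hZ₂stab h F hF⟩
  have h1 : (1 : MvPolynomial (DegIdx (Fin (n + 2)) D) ℂ) ∈ J₁.toSubmodule ⊔ J₂.toSubmodule :=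
    hab ▸ Submodule.add_mem_sup ha hb
  have h1inv : ∀ h : Matrix.SpecialLinearGroup (Fin (n + 2)) ℂ, ρ h 1 = 1 := fun h => by
    rw [hρapp, map_one]
  obtain ⟨a', ha', b', hb', -, hb'inv, hab'⟩ :=
    exists_invariant_add_eq_of_mem_sup (isSemisimpleRepresentation_coordRep_comp_toGL hm D) J₁ J₂
      h1 h1inv
  refine ⟨b', fun h => hb'inv h, ?_, fun G hG hGsing => ?_⟩
  · -- `b'(F₀) = 1 - a'(F₀) = 1`
    have ha'0 : aeval (formCoeff D F₀) a' = 0 :=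
      (MvPolynomial.mem_vanishingIdeal_iff.1 ha') _ ⟨F₀, mem_slOrbit_self F₀, rfl⟩
    have := congrArg (aeval (formCoeff D F₀)) hab'
    rwa [map_add, map_one, ha'0, zero_add] at this
  · -- `b'` vanishes on singular forms
    exact (MvPolynomial.mem_vanishingIdeal_iff.1 hb') _ ((hmem G hG).mpr hGsing)

end Singular

end Literature.Computability.AlgebraicComplexity

end
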